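import Summits.AtomisticToContinuum.Crystallization.Theses.FreeSplittingCertificates

/-!
# Route `FreeSplittingCertificates`, item stmt-AtomisticToContinuum-12570 `Ladder`

The three certificate rungs of route `AtomisticToContinuum/Crystallization/FreeSplittingCertificates`
are nested:

* `StrictSplittingRule → FiniteRangeSplitting`: the strict rule's witness `(R, Φ, a, t)` restricts to
  `(R, Φ)`; box/complementarity and feasibility on `δ`-separated configurations are kept verbatim,
  the spacing `a`, the stretch `t` and the strictness clause are dropped.
* `FiniteRangeSplitting → ApproxFiniteRangeSplitting`: the same `(R, Φ)` works for every `ε > 0`,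
  since `e_∞ - ε ≤ e_∞ ≤ Σ_j w_ij V_LJ(r_ij)`.

Pure logic; it records that refuting a lower rung refutes the higher ones (Miękisz-type ladder of
finite-range versus `ε`-certificates). No analysis is used.
-/

namespace Summit.AtomisticToContinuum.Crystallization.Theorems

/-- **Item stmt-AtomisticToContinuum-12570** (`Ladder`, route `FreeSplittingCertificates`):
`(StrictSplittingRule → FiniteRangeSplitting) ∧ (FiniteRangeSplitting → ApproxFiniteRangeSplitting)`.
First conjunct: forget `a`, `t` and strictness from the strict rule's witness. Second conjunct: the
same radius `R` and rule `Φ` serve every `ε > 0` because `e_∞ - ε ≤ e_∞`. [folklore] -/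
theorem ladder_proof :
    Summit.AtomisticToContinuum.Crystallization.Theses.FreeSplittingCertificates.Ladder := by
  unfold Summit.AtomisticToContinuum.Crystallization.Theses.FreeSplittingCertificates.Ladder
  refine ⟨?_, ?_⟩
  · intro hStrict δ hδ
    obtain ⟨R, Φ, _a, _t, hR, _ha, _ht, hΦ, hfeas, _hstrict⟩ := hStrict δ hδ
    exact ⟨R, Φ, hR, hΦ, hfeas⟩
  · intro hFinite δ hδ ε hε
    obtain ⟨R, Φ, hR, hΦ, hfeas⟩ := hFinite δ hδ
    refine ⟨R, Φ, hR, hΦ, ?_⟩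
    intro N x hx i
    have h := hfeas N x hx i
    linarith

end Summit.AtomisticToContinuum.Crystallization.Theorems
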